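import Mathlib
import Literature.NumberTheory.Automorphic.RankinSelbergLocal

/-!
# Sketch — first lemmas of the two crux ideas for `PairLBoundaryJS` (stmt-Langlands-13622), ideator 1

Card `compact-kirillov-local-division`:
* `mellin_entire_of_hasCompactSupport` — the analytic kernel: a Mellin-type integral of a
  compactly supported continuous function against a continuous positive weight is ENTIRE;
* `rsZeta_differentiable_of_compact_kernel` — the same for the tree's local Rankin–Selberg zeta
  integral `rsZeta` (JPSS, `m < n`, non-archimedean `F`): a kernel supported, uniformly in `s`, in a
  fixed compact set of `GL_m(F) ⧸ U_m` gives an entire `Ψ(s; W, W')`.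

Card `archimedean-equal-rank-ord-le-zero`:
* `meromorphicOrderAt_div_nonneg` — "division introduces no pole": if `I` is analytic at `s₀` and
  `Ψ` is meromorphic at `s₀` WITHOUT A ZERO there (`meromorphicOrderAt Ψ s₀ ≤ 0`), then `I / Ψ` has
  non-negative order at `s₀`;
* `exists_transversal_lastRow` — the top Godement kernel can be made compactly supported INSIDE
  `GL_n(ℝ)`: near a full-rank `(n) × (n+1)` real matrix there is a non-empty open set of last rows
  completing every nearby matrix to an invertible one.
-/

open MeasureTheory Filter Topology

set_option linter.dupNamespace false

namespace Summit.Langlands.Langlands.Cruxes.PairLBoundaryJS.Sketch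

/-- **First lemma, card A (analytic kernel).** For a compactly supported continuous `f` on a locally
compact space with a measure finite on compacts, and a continuous weight `w > 0`, the Mellin-type
integral `s ↦ ∫ f(x) w(x)^s dμ` is an entire function of `s`. -/
theorem mellin_entire_of_hasCompactSupport {X : Type*} [TopologicalSpace X] [MeasurableSpace X]
    [BorelSpace X] [LocallyCompactSpace X] (μ : Measure X) [IsFiniteMeasureOnCompacts μ]
    {f : X → ℂ} (hf : Continuous f) (hsupp : HasCompactSupport f)
    {w : X → ℝ} (hw : Continuous w) (hpos : ∀ x, 0 < w x) :
    Differentiable ℂ fun s : ℂ => ∫ x, f x * ((w x : ℂ) ^ s) ∂μ := by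
  sorry

open Literature.NumberTheory.Automorphic in
/-- **First lemma, card A (on the tree's object).** If the JPSS kernel of `Ψ(s; W, W')`
(`rsKernel hmn W W' s`, `m < n`, non-archimedean `F`) is continuous and supported, for every `s`, in
one fixed compact subset `K` of `GL_m(F) ⧸ U_m` — which is the case when the Whittaker function `W`
restricted to the mirabolic `P_n` is compactly supported modulo `N_n` (Gelfand–Kazhdan / Bernstein–
Zelevinsky; Jacquet 2010, Kemarsky 2015 at archimedean places) — then `Ψ(s; W, W') = rsZeta hmn ν W W'`
is an ENTIRE function of `s` (for `ν` finite on compacts). -/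
theorem rsZeta_differentiable_of_compact_kernel
    {F : Type*} [Field F] [ValuativeRel F] [TopologicalSpace F]
    [IsNonarchimedeanLocalField F]
    {n m : ℕ} (hmn : m < n)
    [MeasurableSpace (GL (Fin m) F ⧸ upperUnitriangular (Fin m) F)]
    [BorelSpace (GL (Fin m) F ⧸ upperUnitriangular (Fin m) F)]
    (ν : Measure (GL (Fin m) F ⧸ upperUnitriangular (Fin m) F)) [IsFiniteMeasureOnCompacts ν]
    {W : GL (Fin n) F → ℂ} {W' : GL (Fin m) F → ℂ}
    {K : Set (GL (Fin m) F ⧸ upperUnitriangular (Fin m) F)} (hK : IsCompact K)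
    (hsupp : ∀ s : ℂ, Function.support (rsKernel hmn W W' s) ⊆ K)
    (hcont : ∀ s : ℂ, Continuous (rsKernel hmn W W' s)) :
    Differentiable ℂ (rsZeta hmn ν W W') := by
  sorry

/-- **First lemma, card B ("ord ≤ 0 suffices").** Division by a local integral that is meromorphic
WITHOUT A ZERO at `s₀` introduces no pole at `s₀`: the order of `I / Ψ` at `s₀` is non-negative
whenever `I` is analytic at `s₀` and `meromorphicOrderAt Ψ s₀ ≤ 0`. (No `L`-factor, `ε`-factor or
functional equation of `Ψ` is involved.) -/
theorem meromorphicOrderAt_div_nonneg {I Ψ : ℂ → ℂ} {s₀ : ℂ} (hI : AnalyticAt ℂ I s₀)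
    (hΨ : MeromorphicAt Ψ s₀) (hord : meromorphicOrderAt Ψ s₀ ≤ 0) :
    0 ≤ meromorphicOrderAt (fun s => I s / Ψ s) s₀ := by
  sorry

/-- **First lemma, card B (compact top kernel).** If `A` is a real `n × (n+1)` matrix of rank `n`,
there are a neighbourhood `V` of `A` and a non-empty open set `U` of row vectors such that appending
any `u ∈ U` as last row to any `B ∈ V` yields an invertible `(n+1) × (n+1)` matrix — so the Godement
kernel `Φ ⊗ Φ₁` of Jacquet (2009), (8.1), can be taken compactly supported inside `GL_{n+1}(ℝ)`. -/
theorem exists_transversal_lastRow {n : ℕ} (A : Matrix (Fin n) (Fin (n + 1)) ℝ)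
    (hA : A.rank = n) :
    ∃ V ∈ 𝓝 A, ∃ U : Set (Fin (n + 1) → ℝ), IsOpen U ∧ U.Nonempty ∧
      ∀ B ∈ V, ∀ u ∈ U, (Matrix.of (Fin.snoc B u) : Matrix (Fin (n + 1)) (Fin (n + 1)) ℝ).det ≠ 0 := by
  sorry

end Summit.Langlands.Langlands.Cruxes.PairLBoundaryJS.Sketch
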